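/-
Copyright: the b2b-balaban T⁴-continuum CRUX team, row NE7b OWNER lineage `t4-ne7b-p1` (gen 146). Project licence.
-/
import Summits.QuantumFields.BalabanUV.T4Continuum.Spine.NE7b.SupFivePointCutFullGraph

/-!
# ORDER FIVE BY CUTS UNDER THE FULL-GRAPH WEIGHT — THE WEIGHTED GREEDY INDUCTION, LEVELS TWO AND ONE (SCOPING-d17 §F, the
# five-point term of `M₅` in the WEIGHTED class).  (537)∕(539) turned the fifteen cut bounds `|u₅| ≤ C·(max_{e crossing S} q_e)⁴` into
# `|u₅| ≤ C·t⋆⁴ ≤ C·G_r(q)` (rooted greedy polynomial) and (538)∕(558) summed `G_r` over the free sites.  The weighted slot letters need `t⋆⁴`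
# against the FULL-GRAPH weight
# `Π_{10 pairs}ϑ`, which no single cut controls.  THIS FILE replays the greedy induction WITH THE PAIRS AS CURRENCY: for a kernel `r₁ ≥ 1`,
# symmetric and submultiplicative on sites, and `t ≥ 0` such that EVERY cut `S ∋ x₁` is crossed by a pair with `t·r₁(a,b)⁸ ≤ 1`,
#   `t⁴ · Π_{10 pairs p} r₁(p) ≤ 1`,   i.e.   `t⋆⁴ ≤ Π_{pairs} r₁⁻¹`   (next file, with `t·r₁⁸ ≤ 1` from `t ≤ r⁻¹` and `r₁⁸ ≤ r`).
# INDUCTION on the reached set `S` (claim `t^{5−|S|}·O_S ≤ P_S^{N}`, `O_S`∕`P_S` the products over pairs leaving ∕ inside `S`, `N = 1, 3, 7, 15` at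
# `|S| = 4, 3, 2, 1`): a strong pair `(a,b)` attaches `b`; its `|S|` links are carried to `a` (`r₁(c,b) ≤ r₁(c,a)r₁(a,b)`), so
# `Π_{c∈S} r₁(c,b) ≤ r₁(a,b)^{|S|}·P_S`, and `|S|·(N_{|S|+1}+1) ≤ 8` closes the step (`step`).  ONE lemma per level with the sites as arguments
# (relabelling covers the fifteen subsets), then the assembly over the fifteen cuts (row NE7b, node U5c; Mathlib only; [folklore]).

Cell `pub-balaban`, sub-cell `t4`, spine estimate NE7b (`T4WeightBudget.RelWeightBound`; the cell's OWN estimate — NOT PRINTED in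
[Bałaban 1983–89], NOT PROVED).  Crux-route work under `Spine/NE7b/` by the row OWNER (`t4-ne7b-p1` gen 146, file (682)) under FREEZE
(0)'s crux-prover clause; NOTHING of Bałaban's is named as a Lean object, valued or asserted; no `T4Continuum/Support` leaf typed; no
`def`, no notation (every product WRITTEN OUT); zero `sorry`.  Imports (BY NAME): the OWNER's (681) `…SupFivePointCutFullGraph` (`step`;
Mathlib only through it).

WHAT IS PROVED ([folklore]): **`cut_level2`**, **`cut_level1`** (THE END of the induction: `t⁴·Π_{10 pairs} r₁ ≤ 1` from the four
level-two claims); toy.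

HONEST (what this is NOT).  Finite algebra; the assembly from the fifteen written-out cut maxima of (557)∕(610) (`t⋆`) and the weighted slot sums
are the next files; the exponent `8` is the crude routing's price (`|S|(N+1) ≤ 8`), not optimised.  Scalar skeleton ((A3), NC-NE7b-α UNRULED);
nothing of Bałaban's asserted.  BY-NAME EFFECT ON THE WALL: NONE.  NE7b NOT PRINTED ∕ NOT PROVED; spine PROVED 0∕9; rung (B)+1 — the programme's
measures remain FINITE-torus statements; NOT the mass gap, NOT Clay.  HONEST DEPENDENCY: continuum YM on T⁴ ⇐ BetaPertH ∧ nine spine estimates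
(0∕9 proved); BetaPertH ⇐ (D1) ∧ (D4) ∧ CAP+tail; G-an2-4 gates asym, D1 and NE2∕3∕4.
-/

set_option autoImplicit false

namespace Summit.QuantumFields.BalabanUV.T4Continuum.NE7b.SupFivePointCutFullGraphTwo

open SupFivePointCutFullGraph (step)

/-! ## §1. Levels two and one (sites as arguments) -/

variable {ι : Type} {r₁ : ι → ι → ℝ} {t : ℝ}

set_option maxHeartbeats 800000 in
/-- **Level two** (`|S| = 2`): from the three level-three claims and a strong pair, `t³·O_S ≤ P_S⁷`. [folklore] -/
theorem cut_level2 (ht : 0 ≤ t) (h1 : ∀ x y, 1 ≤ r₁ x y) (hsymm : ∀ x y, r₁ x y = r₁ y x) (hmul : ∀ x y z, r₁ x z ≤ r₁ x y * r₁ y z)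
    (a1 a2 b1 b2 b3 : ι) (hcut : t * r₁ a1 b1 ^ 8 ≤ 1 ∨ t * r₁ a2 b1 ^ 8 ≤ 1 ∨ t * r₁ a1 b2 ^ 8 ≤ 1 ∨ t * r₁ a2 b2 ^ 8 ≤ 1 ∨ t * r₁ a1 b3 ^ 8 ≤ 1 ∨
          t * r₁ a2 b3 ^ 8 ≤ 1)
    (ih1 : t ^ 2 * (r₁ a1 b2 * r₁ a2 b2 * r₁ b1 b2 * r₁ a1 b3 * r₁ a2 b3 * r₁ b1 b3 * r₁ b2 b3) ≤ (r₁ a1 a2 * r₁ a1 b1 * r₁ a2 b1) ^ 3)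
    (ih2 : t ^ 2 * (r₁ a1 b1 * r₁ a2 b1 * r₁ b2 b1 * r₁ a1 b3 * r₁ a2 b3 * r₁ b2 b3 * r₁ b1 b3) ≤ (r₁ a1 a2 * r₁ a1 b2 * r₁ a2 b2) ^ 3)
    (ih3 : t ^ 2 * (r₁ a1 b1 * r₁ a2 b1 * r₁ b3 b1 * r₁ a1 b2 * r₁ a2 b2 * r₁ b3 b2 * r₁ b1 b2) ≤ (r₁ a1 a2 * r₁ a1 b3 * r₁ a2 b3) ^ 3) :
    t ^ 3 * (r₁ a1 b1 * r₁ a2 b1 * r₁ a1 b2 * r₁ a2 b2 * r₁ a1 b3 * r₁ a2 b3 * r₁ b1 b2 * r₁ b1 b3 * r₁ b2 b3) ≤ (r₁ a1 a2) ^ 7 := by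
  have h0 : ∀ a b, 0 ≤ r₁ a b := fun a b => zero_le_one.trans (h1 a b)
  have hm00 : ∀ a c b, r₁ a b ≤ r₁ a c * r₁ c b := fun a c b => hmul a c b
  have hm10 : ∀ a c b, r₁ a b ≤ r₁ c a * r₁ c b := fun a c b => by rw [hsymm c a]; exact hmul a c b
  rcases hcut with h | h | h | h | h | h
  · -- strong pair (a1,b1)
    have ih' : t ^ 2 * (r₁ a1 b2 * r₁ a2 b2 * r₁ b1 b2 * r₁ a1 b3 * r₁ a2 b3 * r₁ b1 b3 * r₁ b2 b3) ≤ ((r₁ a1 a2) * (r₁ a1 b1 * r₁ a2 b1)) ^ 3 :=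
          ih1.trans_eq (by ring)
    have hsub : r₁ a1 a2 ≤ r₁ a1 a2 := by
      exact le_of_eq (by ring)
    have hch : r₁ a2 b1 ≤ (r₁ a1 a2 * r₁ a1 b1) :=
      (hm10 a2 a1 b1)
    have hPbE : r₁ a1 b1 * r₁ a2 b1 ≤ r₁ a1 b1 ^ 2 * (r₁ a1 a2) := by
      calc r₁ a1 b1 * r₁ a2 b1
          _ = r₁ a1 b1 * (r₁ a2 b1) := by ring
          _ ≤ r₁ a1 b1 * ((r₁ a1 a2 * r₁ a1 b1)) := mul_le_mul_of_nonneg_left hch (h0 _ _)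
          _ = r₁ a1 b1 ^ 2 * (r₁ a1 a2) := by ring
          _ ≤ r₁ a1 b1 ^ 2 * (r₁ a1 a2) := mul_le_mul_of_nonneg_left hsub (pow_nonneg (h0 _ _) _)
    have hs := step ht (h1 a1 b1) (h1 _ _) (mul_nonneg (h0 _ _) (h0 _ _)) h (by norm_num : 2 * (3 + 1) ≤ 8) hPbE ih'
    calc t ^ 3 * (r₁ a1 b1 * r₁ a2 b1 * r₁ a1 b2 * r₁ a2 b2 * r₁ a1 b3 * r₁ a2 b3 * r₁ b1 b2 * r₁ b1 b3 * r₁ b2 b3)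
        _ = t ^ (2 + 1) * ((r₁ a1 b1 * r₁ a2 b1) * (r₁ a1 b2 * r₁ a2 b2 * r₁ b1 b2 * r₁ a1 b3 * r₁ a2 b3 * r₁ b1 b3 * r₁ b2 b3)) := by ring
        _ ≤ _ := hs
        _ = (r₁ a1 a2) ^ 7 := by norm_num
  · -- strong pair (a2,b1)
    have ih' : t ^ 2 * (r₁ a1 b2 * r₁ a2 b2 * r₁ b1 b2 * r₁ a1 b3 * r₁ a2 b3 * r₁ b1 b3 * r₁ b2 b3) ≤ ((r₁ a1 a2) * (r₁ a1 b1 * r₁ a2 b1)) ^ 3 :=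
          ih1.trans_eq (by ring)
    have hsub : r₁ a1 a2 ≤ r₁ a1 a2 := by
      exact le_of_eq (by ring)
    have hch : r₁ a1 b1 ≤ (r₁ a1 a2 * r₁ a2 b1) :=
      (hm00 a1 a2 b1)
    have hPbE : r₁ a1 b1 * r₁ a2 b1 ≤ r₁ a2 b1 ^ 2 * (r₁ a1 a2) := by
      calc r₁ a1 b1 * r₁ a2 b1
          _ = r₁ a2 b1 * (r₁ a1 b1) := by ring
          _ ≤ r₁ a2 b1 * ((r₁ a1 a2 * r₁ a2 b1)) := mul_le_mul_of_nonneg_left hch (h0 _ _)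
          _ = r₁ a2 b1 ^ 2 * (r₁ a1 a2) := by ring
          _ ≤ r₁ a2 b1 ^ 2 * (r₁ a1 a2) := mul_le_mul_of_nonneg_left hsub (pow_nonneg (h0 _ _) _)
    have hs := step ht (h1 a2 b1) (h1 _ _) (mul_nonneg (h0 _ _) (h0 _ _)) h (by norm_num : 2 * (3 + 1) ≤ 8) hPbE ih'
    calc t ^ 3 * (r₁ a1 b1 * r₁ a2 b1 * r₁ a1 b2 * r₁ a2 b2 * r₁ a1 b3 * r₁ a2 b3 * r₁ b1 b2 * r₁ b1 b3 * r₁ b2 b3)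
        _ = t ^ (2 + 1) * ((r₁ a1 b1 * r₁ a2 b1) * (r₁ a1 b2 * r₁ a2 b2 * r₁ b1 b2 * r₁ a1 b3 * r₁ a2 b3 * r₁ b1 b3 * r₁ b2 b3)) := by ring
        _ ≤ _ := hs
        _ = (r₁ a1 a2) ^ 7 := by norm_num
  · -- strong pair (a1,b2)
    have ih := ih2
    rw [hsymm b2 b1] at ih
    have ih' : t ^ 2 * (r₁ a1 b1 * r₁ a2 b1 * r₁ b1 b2 * r₁ a1 b3 * r₁ a2 b3 * r₁ b2 b3 * r₁ b1 b3) ≤ ((r₁ a1 a2) * (r₁ a1 b2 * r₁ a2 b2)) ^ 3 :=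
          ih.trans_eq (by ring)
    have hsub : r₁ a1 a2 ≤ r₁ a1 a2 := by
      exact le_of_eq (by ring)
    have hch : r₁ a2 b2 ≤ (r₁ a1 a2 * r₁ a1 b2) :=
      (hm10 a2 a1 b2)
    have hPbE : r₁ a1 b2 * r₁ a2 b2 ≤ r₁ a1 b2 ^ 2 * (r₁ a1 a2) := by
      calc r₁ a1 b2 * r₁ a2 b2
          _ = r₁ a1 b2 * (r₁ a2 b2) := by ring
          _ ≤ r₁ a1 b2 * ((r₁ a1 a2 * r₁ a1 b2)) := mul_le_mul_of_nonneg_left hch (h0 _ _)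
          _ = r₁ a1 b2 ^ 2 * (r₁ a1 a2) := by ring
          _ ≤ r₁ a1 b2 ^ 2 * (r₁ a1 a2) := mul_le_mul_of_nonneg_left hsub (pow_nonneg (h0 _ _) _)
    have hs := step ht (h1 a1 b2) (h1 _ _) (mul_nonneg (h0 _ _) (h0 _ _)) h (by norm_num : 2 * (3 + 1) ≤ 8) hPbE ih'
    calc t ^ 3 * (r₁ a1 b1 * r₁ a2 b1 * r₁ a1 b2 * r₁ a2 b2 * r₁ a1 b3 * r₁ a2 b3 * r₁ b1 b2 * r₁ b1 b3 * r₁ b2 b3)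
        _ = t ^ (2 + 1) * ((r₁ a1 b2 * r₁ a2 b2) * (r₁ a1 b1 * r₁ a2 b1 * r₁ b1 b2 * r₁ a1 b3 * r₁ a2 b3 * r₁ b2 b3 * r₁ b1 b3)) := by ring
        _ ≤ _ := hs
        _ = (r₁ a1 a2) ^ 7 := by norm_num
  · -- strong pair (a2,b2)
    have ih := ih2
    rw [hsymm b2 b1] at ih
    have ih' : t ^ 2 * (r₁ a1 b1 * r₁ a2 b1 * r₁ b1 b2 * r₁ a1 b3 * r₁ a2 b3 * r₁ b2 b3 * r₁ b1 b3) ≤ ((r₁ a1 a2) * (r₁ a1 b2 * r₁ a2 b2)) ^ 3 :=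
          ih.trans_eq (by ring)
    have hsub : r₁ a1 a2 ≤ r₁ a1 a2 := by
      exact le_of_eq (by ring)
    have hch : r₁ a1 b2 ≤ (r₁ a1 a2 * r₁ a2 b2) :=
      (hm00 a1 a2 b2)
    have hPbE : r₁ a1 b2 * r₁ a2 b2 ≤ r₁ a2 b2 ^ 2 * (r₁ a1 a2) := by
      calc r₁ a1 b2 * r₁ a2 b2
          _ = r₁ a2 b2 * (r₁ a1 b2) := by ring
          _ ≤ r₁ a2 b2 * ((r₁ a1 a2 * r₁ a2 b2)) := mul_le_mul_of_nonneg_left hch (h0 _ _)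
          _ = r₁ a2 b2 ^ 2 * (r₁ a1 a2) := by ring
          _ ≤ r₁ a2 b2 ^ 2 * (r₁ a1 a2) := mul_le_mul_of_nonneg_left hsub (pow_nonneg (h0 _ _) _)
    have hs := step ht (h1 a2 b2) (h1 _ _) (mul_nonneg (h0 _ _) (h0 _ _)) h (by norm_num : 2 * (3 + 1) ≤ 8) hPbE ih'
    calc t ^ 3 * (r₁ a1 b1 * r₁ a2 b1 * r₁ a1 b2 * r₁ a2 b2 * r₁ a1 b3 * r₁ a2 b3 * r₁ b1 b2 * r₁ b1 b3 * r₁ b2 b3)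
        _ = t ^ (2 + 1) * ((r₁ a1 b2 * r₁ a2 b2) * (r₁ a1 b1 * r₁ a2 b1 * r₁ b1 b2 * r₁ a1 b3 * r₁ a2 b3 * r₁ b2 b3 * r₁ b1 b3)) := by ring
        _ ≤ _ := hs
        _ = (r₁ a1 a2) ^ 7 := by norm_num
  · -- strong pair (a1,b3)
    have ih := ih3
    rw [hsymm b3 b1, hsymm b3 b2] at ih
    have ih' : t ^ 2 * (r₁ a1 b1 * r₁ a2 b1 * r₁ b1 b3 * r₁ a1 b2 * r₁ a2 b2 * r₁ b2 b3 * r₁ b1 b2) ≤ ((r₁ a1 a2) * (r₁ a1 b3 * r₁ a2 b3)) ^ 3 :=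
          ih.trans_eq (by ring)
    have hsub : r₁ a1 a2 ≤ r₁ a1 a2 := by
      exact le_of_eq (by ring)
    have hch : r₁ a2 b3 ≤ (r₁ a1 a2 * r₁ a1 b3) :=
      (hm10 a2 a1 b3)
    have hPbE : r₁ a1 b3 * r₁ a2 b3 ≤ r₁ a1 b3 ^ 2 * (r₁ a1 a2) := by
      calc r₁ a1 b3 * r₁ a2 b3
          _ = r₁ a1 b3 * (r₁ a2 b3) := by ring
          _ ≤ r₁ a1 b3 * ((r₁ a1 a2 * r₁ a1 b3)) := mul_le_mul_of_nonneg_left hch (h0 _ _)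
          _ = r₁ a1 b3 ^ 2 * (r₁ a1 a2) := by ring
          _ ≤ r₁ a1 b3 ^ 2 * (r₁ a1 a2) := mul_le_mul_of_nonneg_left hsub (pow_nonneg (h0 _ _) _)
    have hs := step ht (h1 a1 b3) (h1 _ _) (mul_nonneg (h0 _ _) (h0 _ _)) h (by norm_num : 2 * (3 + 1) ≤ 8) hPbE ih'
    calc t ^ 3 * (r₁ a1 b1 * r₁ a2 b1 * r₁ a1 b2 * r₁ a2 b2 * r₁ a1 b3 * r₁ a2 b3 * r₁ b1 b2 * r₁ b1 b3 * r₁ b2 b3)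
        _ = t ^ (2 + 1) * ((r₁ a1 b3 * r₁ a2 b3) * (r₁ a1 b1 * r₁ a2 b1 * r₁ b1 b3 * r₁ a1 b2 * r₁ a2 b2 * r₁ b2 b3 * r₁ b1 b2)) := by ring
        _ ≤ _ := hs
        _ = (r₁ a1 a2) ^ 7 := by norm_num
  · -- strong pair (a2,b3)
    have ih := ih3
    rw [hsymm b3 b1, hsymm b3 b2] at ih
    have ih' : t ^ 2 * (r₁ a1 b1 * r₁ a2 b1 * r₁ b1 b3 * r₁ a1 b2 * r₁ a2 b2 * r₁ b2 b3 * r₁ b1 b2) ≤ ((r₁ a1 a2) * (r₁ a1 b3 * r₁ a2 b3)) ^ 3 :=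
          ih.trans_eq (by ring)
    have hsub : r₁ a1 a2 ≤ r₁ a1 a2 := by
      exact le_of_eq (by ring)
    have hch : r₁ a1 b3 ≤ (r₁ a1 a2 * r₁ a2 b3) :=
      (hm00 a1 a2 b3)
    have hPbE : r₁ a1 b3 * r₁ a2 b3 ≤ r₁ a2 b3 ^ 2 * (r₁ a1 a2) := by
      calc r₁ a1 b3 * r₁ a2 b3
          _ = r₁ a2 b3 * (r₁ a1 b3) := by ring
          _ ≤ r₁ a2 b3 * ((r₁ a1 a2 * r₁ a2 b3)) := mul_le_mul_of_nonneg_left hch (h0 _ _)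
          _ = r₁ a2 b3 ^ 2 * (r₁ a1 a2) := by ring
          _ ≤ r₁ a2 b3 ^ 2 * (r₁ a1 a2) := mul_le_mul_of_nonneg_left hsub (pow_nonneg (h0 _ _) _)
    have hs := step ht (h1 a2 b3) (h1 _ _) (mul_nonneg (h0 _ _) (h0 _ _)) h (by norm_num : 2 * (3 + 1) ≤ 8) hPbE ih'
    calc t ^ 3 * (r₁ a1 b1 * r₁ a2 b1 * r₁ a1 b2 * r₁ a2 b2 * r₁ a1 b3 * r₁ a2 b3 * r₁ b1 b2 * r₁ b1 b3 * r₁ b2 b3)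
        _ = t ^ (2 + 1) * ((r₁ a1 b3 * r₁ a2 b3) * (r₁ a1 b1 * r₁ a2 b1 * r₁ b1 b3 * r₁ a1 b2 * r₁ a2 b2 * r₁ b2 b3 * r₁ b1 b2)) := by ring
        _ ≤ _ := hs
        _ = (r₁ a1 a2) ^ 7 := by norm_num

set_option maxHeartbeats 800000 in
/-- **Level one** (the root): from the four level-two claims and a strong pair at the root, `t⁴·Π_{10 pairs} r₁ ≤ 1`. [folklore] -/
theorem cut_level1 (ht : 0 ≤ t) (h1 : ∀ x y, 1 ≤ r₁ x y) (hsymm : ∀ x y, r₁ x y = r₁ y x) (hmul : ∀ x y z, r₁ x z ≤ r₁ x y * r₁ y z)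
    (a1 b1 b2 b3 b4 : ι) (hcut : t * r₁ a1 b1 ^ 8 ≤ 1 ∨ t * r₁ a1 b2 ^ 8 ≤ 1 ∨ t * r₁ a1 b3 ^ 8 ≤ 1 ∨ t * r₁ a1 b4 ^ 8 ≤ 1)
    (ih1 : t ^ 3 * (r₁ a1 b2 * r₁ b1 b2 * r₁ a1 b3 * r₁ b1 b3 * r₁ a1 b4 * r₁ b1 b4 * r₁ b2 b3 * r₁ b2 b4 * r₁ b3 b4) ≤ (r₁ a1 b1) ^ 7)
    (ih2 : t ^ 3 * (r₁ a1 b1 * r₁ b2 b1 * r₁ a1 b3 * r₁ b2 b3 * r₁ a1 b4 * r₁ b2 b4 * r₁ b1 b3 * r₁ b1 b4 * r₁ b3 b4) ≤ (r₁ a1 b2) ^ 7)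
    (ih3 : t ^ 3 * (r₁ a1 b1 * r₁ b3 b1 * r₁ a1 b2 * r₁ b3 b2 * r₁ a1 b4 * r₁ b3 b4 * r₁ b1 b2 * r₁ b1 b4 * r₁ b2 b4) ≤ (r₁ a1 b3) ^ 7)
    (ih4 : t ^ 3 * (r₁ a1 b1 * r₁ b4 b1 * r₁ a1 b2 * r₁ b4 b2 * r₁ a1 b3 * r₁ b4 b3 * r₁ b1 b2 * r₁ b1 b3 * r₁ b2 b3) ≤ (r₁ a1 b4) ^ 7) :
    t ^ 4 * (r₁ a1 b1 * r₁ a1 b2 * r₁ a1 b3 * r₁ a1 b4 * r₁ b1 b2 * r₁ b1 b3 * r₁ b1 b4 * r₁ b2 b3 * r₁ b2 b4 * r₁ b3 b4) ≤ 1 := by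
  have h0 : ∀ a b, 0 ≤ r₁ a b := fun a b => zero_le_one.trans (h1 a b)
  have hm00 : ∀ a c b, r₁ a b ≤ r₁ a c * r₁ c b := fun a c b => hmul a c b
  have hm10 : ∀ a c b, r₁ a b ≤ r₁ c a * r₁ c b := fun a c b => by rw [hsymm c a]; exact hmul a c b
  rcases hcut with h | h | h | h
  · -- strong pair (a1,b1)
    have ih' : t ^ 3 * (r₁ a1 b2 * r₁ b1 b2 * r₁ a1 b3 * r₁ b1 b3 * r₁ a1 b4 * r₁ b1 b4 * r₁ b2 b3 * r₁ b2 b4 * r₁ b3 b4) ≤ ((1 : ℝ) * (r₁ a1 b1))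
          ^ 7 := ih1.trans_eq (by ring)
    have hPbE : r₁ a1 b1 ≤ r₁ a1 b1 ^ 1 * (1 : ℝ) := le_of_eq (by ring)
    have hs := step ht (h1 a1 b1) (le_refl (1 : ℝ)) (h0 _ _) h (by norm_num : 1 * (7 + 1) ≤ 8) hPbE ih'
    calc t ^ 4 * (r₁ a1 b1 * r₁ a1 b2 * r₁ a1 b3 * r₁ a1 b4 * r₁ b1 b2 * r₁ b1 b3 * r₁ b1 b4 * r₁ b2 b3 * r₁ b2 b4 * r₁ b3 b4)
        _ = t ^ (3 + 1) * ((r₁ a1 b1) * (r₁ a1 b2 * r₁ b1 b2 * r₁ a1 b3 * r₁ b1 b3 * r₁ a1 b4 * r₁ b1 b4 * r₁ b2 b3 * r₁ b2 b4 * r₁ b3 b4)) := by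
              ring
        _ ≤ _ := hs
        _ = 1 := by norm_num
  · -- strong pair (a1,b2)
    have ih := ih2
    rw [hsymm b2 b1] at ih
    have ih' : t ^ 3 * (r₁ a1 b1 * r₁ b1 b2 * r₁ a1 b3 * r₁ b2 b3 * r₁ a1 b4 * r₁ b2 b4 * r₁ b1 b3 * r₁ b1 b4 * r₁ b3 b4) ≤ ((1 : ℝ) * (r₁ a1 b2))
          ^ 7 := ih.trans_eq (by ring)
    have hPbE : r₁ a1 b2 ≤ r₁ a1 b2 ^ 1 * (1 : ℝ) := le_of_eq (by ring)
    have hs := step ht (h1 a1 b2) (le_refl (1 : ℝ)) (h0 _ _) h (by norm_num : 1 * (7 + 1) ≤ 8) hPbE ih'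
    calc t ^ 4 * (r₁ a1 b1 * r₁ a1 b2 * r₁ a1 b3 * r₁ a1 b4 * r₁ b1 b2 * r₁ b1 b3 * r₁ b1 b4 * r₁ b2 b3 * r₁ b2 b4 * r₁ b3 b4)
        _ = t ^ (3 + 1) * ((r₁ a1 b2) * (r₁ a1 b1 * r₁ b1 b2 * r₁ a1 b3 * r₁ b2 b3 * r₁ a1 b4 * r₁ b2 b4 * r₁ b1 b3 * r₁ b1 b4 * r₁ b3 b4)) := by
              ring
        _ ≤ _ := hs
        _ = 1 := by norm_num
  · -- strong pair (a1,b3)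
    have ih := ih3
    rw [hsymm b3 b1, hsymm b3 b2] at ih
    have ih' : t ^ 3 * (r₁ a1 b1 * r₁ b1 b3 * r₁ a1 b2 * r₁ b2 b3 * r₁ a1 b4 * r₁ b3 b4 * r₁ b1 b2 * r₁ b1 b4 * r₁ b2 b4) ≤ ((1 : ℝ) * (r₁ a1 b3))
          ^ 7 := ih.trans_eq (by ring)
    have hPbE : r₁ a1 b3 ≤ r₁ a1 b3 ^ 1 * (1 : ℝ) := le_of_eq (by ring)
    have hs := step ht (h1 a1 b3) (le_refl (1 : ℝ)) (h0 _ _) h (by norm_num : 1 * (7 + 1) ≤ 8) hPbE ih'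
    calc t ^ 4 * (r₁ a1 b1 * r₁ a1 b2 * r₁ a1 b3 * r₁ a1 b4 * r₁ b1 b2 * r₁ b1 b3 * r₁ b1 b4 * r₁ b2 b3 * r₁ b2 b4 * r₁ b3 b4)
        _ = t ^ (3 + 1) * ((r₁ a1 b3) * (r₁ a1 b1 * r₁ b1 b3 * r₁ a1 b2 * r₁ b2 b3 * r₁ a1 b4 * r₁ b3 b4 * r₁ b1 b2 * r₁ b1 b4 * r₁ b2 b4)) := by
              ring
        _ ≤ _ := hs
        _ = 1 := by norm_num
  · -- strong pair (a1,b4)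
    have ih := ih4
    rw [hsymm b4 b1, hsymm b4 b2, hsymm b4 b3] at ih
    have ih' : t ^ 3 * (r₁ a1 b1 * r₁ b1 b4 * r₁ a1 b2 * r₁ b2 b4 * r₁ a1 b3 * r₁ b3 b4 * r₁ b1 b2 * r₁ b1 b3 * r₁ b2 b3) ≤ ((1 : ℝ) * (r₁ a1 b4))
          ^ 7 := ih.trans_eq (by ring)
    have hPbE : r₁ a1 b4 ≤ r₁ a1 b4 ^ 1 * (1 : ℝ) := le_of_eq (by ring)
    have hs := step ht (h1 a1 b4) (le_refl (1 : ℝ)) (h0 _ _) h (by norm_num : 1 * (7 + 1) ≤ 8) hPbE ih'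
    calc t ^ 4 * (r₁ a1 b1 * r₁ a1 b2 * r₁ a1 b3 * r₁ a1 b4 * r₁ b1 b2 * r₁ b1 b3 * r₁ b1 b4 * r₁ b2 b3 * r₁ b2 b4 * r₁ b3 b4)
        _ = t ^ (3 + 1) * ((r₁ a1 b4) * (r₁ a1 b1 * r₁ b1 b4 * r₁ a1 b2 * r₁ b2 b4 * r₁ a1 b3 * r₁ b3 b4 * r₁ b1 b2 * r₁ b1 b3 * r₁ b2 b3)) := by
              ring
        _ ≤ _ := hs
        _ = 1 := by norm_num


/-! ## §2. Toy -/

/-- Toy (the claim exponents): `N = 2N′ + 1` runs `0 ↦ 1 ↦ 3 ↦ 7 ↦ 15` from the full set down to the root. -/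
example : 2 * 0 + 1 = 1 ∧ 2 * 1 + 1 = 3 ∧ 2 * 3 + 1 = 7 ∧ 2 * 7 + 1 = 15 := by norm_num

end Summit.QuantumFields.BalabanUV.T4Continuum.NE7b.SupFivePointCutFullGraphTwo
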